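import Summits.AtomisticToContinuum.HydrodynamicLimit.Theorems.AntiMazurCoboundariesKineticWindowGronwallWindowEnergyMoment
import Literature.MathematicalPhysics.KineticTheory.CollisionWindowBookkeeping
import Literature.MathematicalPhysics.KineticTheory.HardSphereEulerProofs
import Literature.Analysis.FluidPDE.HardSphereMomentumConservation
import Literature.Analysis.FluidPDE.HardSpherePhaseSpaceProofs
import HarnessLib

/-!
# Rényi quasi-invariance of DENSITY-ONLY local Gibbs laws over kinetic windows
# (stub `stub_densityOnlyWindowRenyi`, line `board-node-dock`, crux `KineticWindowGronwall`, stmt-AtomisticToContinuum-9282)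

Crux `Summit.AtomisticToContinuum.HydrodynamicLimit.Theses.AntiMazurCoboundaries.KineticWindowGronwall`. The load-bearing
stub of the line is the LOCAL kinetic node `KineticWindowGronwallPlusNode.KineticWindowLDBoundsUniform`, a window LD bound
under local Gibbs laws `λ_N = ψ_N · L` (`L` Liouville, flow-invariant; `ψ_N` NOT invariant). Time-shifted windows under `λ_N`
(window clause, subadditivity, static Jensen steps) are paid by the order-`p` Rényi integral `∫ (ψ_N(Φ_{-s}z)/ψ_N(z))^p dλ_N`
(companions `stub_renyiHolderTransfer`, `stub_windowClauseOfRenyi`). THIS FILE: for DENSITY-ONLY data (constant `θc`, `uc`;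
continuous activity `a > 0`) that integral is `≤ e^{ε(N+1)}` for every `p ≥ 1`, eventually in `N`, uniformly over flows
and shifts `|s| ≤ τ(N+1)^{-1/3}`: the Maxwellian factor `∏ᵢ M_{1,uc,θc}(vᵢ)` is FROZEN on good orbits (`Σᵢ‖vᵢ − uc‖²` is a
combination of the conserved energy and momentum, `HardSphereFlow.configEnergy_flow` / `configMomentum_flow`); the activity
factor moves by `exp(Σᵢ(log a(xᵢ') − log a(xᵢ)))` with `|log a x' − log a x| ≤ δ + K·dist` (uniform continuity on `𝕋³`) and
`Σᵢ dist(xᵢ(−s), xᵢ(0)) ≤ |s|((N+1)/2 + E)` (path length against energy, `sum_integral_norm_vel_le`); the remaining moment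
`∫ e^{pK|s|E} dλ_N` factorises over the Gaussian velocity fibres (`lintegral_localGibbsMeasure`) and is
`≤ e^{(N+1)(1 + 2‖uc‖² + 12θc)pK|s|/2}` for `pK|s| ≤ 1/(4θc)`; `|s| → 0` makes the exponent `≤ ε(N+1)` eventually.
Folklore (local equilibrium states, Spohn 1991 Part I §2.3; conservation laws of the hard-sphere flow, GST 2013 §1.1).
No Theses declaration is concluded; no named fact is used.
-/

noncomputable section

namespace Summit.AtomisticToContinuum.HydrodynamicLimit.Theorems.KineticWindowGronwallDensityOnlyWindowRenyi

open _root_.MeasureTheory _root_.Set _root_.Filter _root_.Topology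
open scoped _root_.ENNReal
open Literature.Analysis.FluidPDE Literature.MathematicalPhysics.KineticTheory

/-! ## §1 Statements (verbatim from the line's toolkit `Cruxes/KineticWindowGronwall/Lines/board_node_dock_toolkit.lean`) -/

/-- The hard-sphere flow of `N+1` spheres at reduced density `σ` on `𝕋³`. -/
abbrev TFlow (σ : ℝ) (N : ℕ) : Type :=
  HardSphereFlow (Torus.geometry (Fin 3)) (hsDiameter σ N) (N + 1)

/-- The local Gibbs DENSITY with respect to the Liouville measure (the canonical density of the local Gibbs profile,
as an extended nonnegative real): `localGibbsLaw σ a u₀ θ₀ N Φ = (Liouville).withDensity (lgDensity σ a θ₀ u₀ N)`. -/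
def lgDensity (σ : ℝ) (a θ₀ : T3 → ℝ) (u₀ : T3 → V3) (N : ℕ) (z : Config (N + 1) (Fin 3) T3) : ℝ≥0∞ :=
  ENNReal.ofReal (canonicalDensity (Torus.geometry (Fin 3)) (hsDiameter σ N) (N + 1) (localGibbsProfile a u₀ θ₀) z)

/-- **Helper statement `DensityOnlyWindowRenyi`**: order-`p` Rényi quasi-invariance of DENSITY-ONLY local Gibbs laws
(constant temperature `θc`, constant drift `uc`, continuous activity `a > 0`) over kinetic windows: for every `p ≥ 1`,
`τ > 0`, `ε > 0`, eventually in `N`, for every flow and every shift `|s| ≤ τ(N+1)^{-1/3}`,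
`∫ (ψ_N(Φ_{-s} z)/ψ_N(z))^p λ_N(dz) ≤ e^{ε(N+1)}`. -/
def DensityOnlyWindowRenyi : Prop :=
  ∀ (θc : ℝ), 0 < θc → ∀ (uc : V3) (a : T3 → ℝ), Continuous a → (∀ x, 0 < a x) →
    ∀ (σ p : ℝ), 1 ≤ p → ∀ (τ ε : ℝ), 0 < τ → 0 < ε →
    ∃ N₀ : ℕ, ∀ N : ℕ, N₀ ≤ N → ∀ (Φ : TFlow σ N) (s : ℝ), |s| ≤ τ * ((N : ℝ) + 1) ^ (-(1 / 3 : ℝ)) →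
      ∫⁻ z, (lgDensity σ a (fun _ => θc) (fun _ => uc) N (Φ.flow (-s) z) /
              lgDensity σ a (fun _ => θc) (fun _ => uc) N z) ^ p
          ∂(localGibbsLaw σ a (fun _ => uc) (fun _ => θc) N Φ) ≤
        ENNReal.ofReal (Real.exp (ε * ((N : ℝ) + 1)))

/-! ## §2 Statics on the torus: a modulus of continuity against the minimal-image distance -/

/-- A continuous real function on `𝕋³` has, for every `δ > 0`, an affine modulus against the minimal-image distance:
`|g x − g y| ≤ δ + K · euclidDist x y` (uniform continuity on the compact torus, boundedness, and
`‖x − y‖ ≤ euclidDist x y`). [folklore] -/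
theorem exists_affine_modulus {g : T3 → ℝ} (hg : Continuous g) {δ : ℝ} (hδ : 0 < δ) :
    ∃ K : ℝ, 0 ≤ K ∧ ∀ x y : T3, |g x - g y| ≤ δ + K * Torus.euclidDist x y := by
  obtain ⟨B, hB0, hB⟩ := exists_forall_abs_le_of_continuous hg
  have huc : UniformContinuous g := CompactSpace.uniformContinuous_of_continuous hg
  obtain ⟨η, hη, hηg⟩ := Metric.uniformContinuous_iff.1 huc δ hδ
  refine ⟨2 * B / η, by positivity, fun x y => ?_⟩
  by_cases hxy : Torus.euclidDist x y < η
  · have hd : dist x y < η := by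
      rw [dist_eq_norm]
      exact (Torus.norm_sub_le_euclidDist_holds x y).trans_lt hxy
    have h := hηg hd
    rw [Real.dist_eq] at h
    have : 0 ≤ 2 * B / η * Torus.euclidDist x y :=
      mul_nonneg (by positivity) (by rw [Torus.euclidDist_eq]; exact norm_nonneg _)
    linarith
  · push Not at hxy
    have h1 : |g x - g y| ≤ 2 * B := by
      have := abs_sub (g x) (g y)
      linarith [hB x, hB y]
    have h2 : 2 * B ≤ 2 * B / η * Torus.euclidDist x y := by
      rw [div_mul_eq_mul_div, le_div_iff₀ hη]
      exact mul_le_mul_of_nonneg_left hxy (by positivity)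
    linarith

/-! ## §3 Dynamics on good orbits: displacement against energy, and the frozen Maxwellian factor -/

section Flow

variable {σ : ℝ} {N : ℕ} (Φ : TFlow σ N)

/-- **Total backward/forward displacement against energy**: along a good orbit, for every real `s`,
`Σᵢ dist(xᵢ(−s), xᵢ(0)) ≤ |s| ((N+1)/2 + E(z))` (path length, `‖v‖ ≤ ½ + ½‖v‖²`, energy conservation). [folklore] -/
theorem sum_euclidDist_flow_neg_le {z : Config (N + 1) (Fin 3) T3} (hz : z ∈ Φ.good) (s : ℝ) :
    ∑ i, Torus.euclidDist ((Φ.flow (-s) z i).1) ((z i).1) ≤ |s| * (((N : ℝ) + 1) / 2 + configEnergy z) := by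
  rcases le_or_gt 0 s with hs | hs
  · -- backward: `dist(x_i(-s), x_i(0)) ≤ ∫_{-s}^0 ‖v_i‖`
    have h1 : ∀ i, Torus.euclidDist ((Φ.flow (-s) z i).1) ((z i).1) ≤ ∫ u in (-s)..0, ‖(Φ.flow u z i).2‖ := by
      intro i
      simpa only [Φ.flow_zero z hz] using Φ.euclidDist_flow_le_integral_norm_vel_comm hz i (neg_nonpos.2 hs)
    calc ∑ i, Torus.euclidDist ((Φ.flow (-s) z i).1) ((z i).1)
        ≤ ∑ i, ∫ u in (-s)..0, ‖(Φ.flow u z i).2‖ := Finset.sum_le_sum fun i _ => h1 i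
      _ ≤ (0 - -s) * (((N + 1 : ℕ) : ℝ) / 2 + configEnergy z) := sum_integral_norm_vel_le Φ hz (neg_nonpos.2 hs)
      _ = |s| * (((N : ℝ) + 1) / 2 + configEnergy z) := by rw [abs_of_nonneg hs]; push_cast; ring
  · -- forward: `dist(x_i(-s), x_i(0)) ≤ ∫_0^{-s} ‖v_i‖`
    have hs' : (0 : ℝ) ≤ -s := by linarith
    have h1 : ∀ i, Torus.euclidDist ((Φ.flow (-s) z i).1) ((z i).1) ≤ ∫ u in (0 : ℝ)..(-s), ‖(Φ.flow u z i).2‖ := by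
      intro i
      simpa only [Φ.flow_zero z hz] using Φ.euclidDist_flow_le_integral_norm_vel hz i hs'
    calc ∑ i, Torus.euclidDist ((Φ.flow (-s) z i).1) ((z i).1)
        ≤ ∑ i, ∫ u in (0 : ℝ)..(-s), ‖(Φ.flow u z i).2‖ := Finset.sum_le_sum fun i _ => h1 i
      _ ≤ (-s - 0) * (((N + 1 : ℕ) : ℝ) / 2 + configEnergy z) := sum_integral_norm_vel_le Φ hz hs'
      _ = |s| * (((N : ℝ) + 1) / 2 + configEnergy z) := by rw [abs_of_neg hs]; push_cast; ring

/-- `Σᵢ ‖vᵢ − u‖² = 2E(z) − 2⟪P(z), u⟫ + (N+1)‖u‖²`: the thermal energy about a constant drift is a combination of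
the kinetic energy and the total momentum. [folklore] -/
theorem sum_norm_sub_sq_eq (z : Config (N + 1) (Fin 3) T3) (u : V3) :
    ∑ i, ‖(z i).2 - u‖ ^ 2 = 2 * configEnergy z - 2 * inner ℝ (configMomentum z) u + ((N : ℝ) + 1) * ‖u‖ ^ 2 := by
  have h : ∀ i, ‖(z i).2 - u‖ ^ 2 = ‖(z i).2‖ ^ 2 - 2 * inner ℝ (z i).2 u + ‖u‖ ^ 2 := fun i =>
    norm_sub_sq_real _ _
  simp only [h, Finset.sum_add_distrib, Finset.sum_sub_distrib, Finset.sum_const, Finset.card_univ,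
    Fintype.card_fin, nsmul_eq_mul, configEnergy, configMomentum, sum_inner, Finset.mul_sum]
  push_cast
  ring

/-- **The Maxwellian factor is frozen along good orbits** (constant temperature and drift):
`Σᵢ ‖vᵢ(t) − u‖² = Σᵢ ‖vᵢ(0) − u‖²` by conservation of energy and momentum. [folklore] -/
theorem sum_norm_sub_sq_flow_eq {z : Config (N + 1) (Fin 3) T3} (hz : z ∈ Φ.good) (t : ℝ) (u : V3) :
    ∑ i, ‖(Φ.flow t z i).2 - u‖ ^ 2 = ∑ i, ‖(z i).2 - u‖ ^ 2 := by
  rw [sum_norm_sub_sq_eq, sum_norm_sub_sq_eq, Φ.configEnergy_flow hz t, Φ.configMomentum_flow hz t]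

/-- The product of local Maxwellians at constant parameters is a function of `Σᵢ ‖vᵢ − u‖²` only:
`∏ᵢ M_{1,u,θ}(vᵢ) = c^{N+1} exp(−Σᵢ‖vᵢ − u‖²/(2θ))`. [folklore] -/
theorem prod_localMaxwellian_eq (z : Config (N + 1) (Fin 3) T3) (θ : ℝ) (u : V3) :
    ∏ i, localMaxwellian 1 θ u (z i).2 =
      (1 * (2 * Real.pi * θ) ^ (-(Module.finrank ℝ V3 : ℝ) / 2)) ^ (N + 1) *
        Real.exp (-(∑ i, ‖(z i).2 - u‖ ^ 2) / (2 * θ)) := by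
  simp only [localMaxwellian]
  rw [Finset.prod_mul_distrib, Finset.prod_const, Finset.card_univ, Fintype.card_fin, ← Real.exp_sum]
  congr 1
  rw [neg_div, Finset.sum_div, ← Finset.sum_neg_distrib]
  refine congrArg Real.exp (Finset.sum_congr rfl fun i _ => ?_)
  ring

/-- Along a good orbit the product of constant-parameter Maxwellians is conserved. [folklore] -/
theorem prod_localMaxwellian_flow_eq {z : Config (N + 1) (Fin 3) T3} (hz : z ∈ Φ.good) (t θ : ℝ) (u : V3) :
    ∏ i, localMaxwellian 1 θ u (Φ.flow t z i).2 = ∏ i, localMaxwellian 1 θ u (z i).2 := by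
  rw [prod_localMaxwellian_eq, prod_localMaxwellian_eq, sum_norm_sub_sq_flow_eq Φ hz t u]

end Flow

/-! ## §4 The ratio of transported to untransported local Gibbs densities on good orbits -/

section Ratio

variable {σ : ℝ} {N : ℕ} (Φ : TFlow σ N) {θc : ℝ} {uc : V3} {a : T3 → ℝ}

/-- The canonical density of a density-only local Gibbs profile ON THE HARD-SPHERE DOMAIN:
`Z⁻¹ · (∏ᵢ a(xᵢ)) · ∏ᵢ M_{1,uc,θc}(vᵢ)`. [folklore] -/
theorem canonicalDensity_eq_of_mem {z : Config (N + 1) (Fin 3) T3}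
    (hz : z ∈ hardSphereDomain (Torus.geometry (Fin 3)) (N + 1) (hsDiameter σ N)) :
    canonicalDensity (Torus.geometry (Fin 3)) (hsDiameter σ N) (N + 1)
        (localGibbsProfile a (fun _ => uc) (fun _ => θc)) z =
      (canonicalPartition (Torus.geometry (Fin 3)) (hsDiameter σ N) (N + 1)
          (localGibbsProfile a (fun _ => uc) (fun _ => θc)))⁻¹ *
        ((∏ i, a (z i).1) * ∏ i, localMaxwellian 1 θc uc (z i).2) := by
  rw [canonicalDensity, Set.indicator_of_mem hz, tensorPow, ← Finset.prod_mul_distrib]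
  rfl

/-- The activity product is the exponential of the sum of the log-activities (`a > 0`). [folklore] -/
theorem prod_activity_eq_exp (ha0 : ∀ x, 0 < a x) (z : Config (N + 1) (Fin 3) T3) :
    ∏ i, a (z i).1 = Real.exp (∑ i, Real.log (a (z i).1)) := by
  rw [Real.exp_sum]
  exact Finset.prod_congr rfl fun i _ => (Real.exp_log (ha0 _)).symm

/-- **The density ratio on good orbits.** For a good datum `z`, `w = Φ_{-s} z` and the density-only profile: if the
log-activity has the affine modulus `|log a x − log a y| ≤ δ + K·dist(x, y)`, then
`ψ(w)/ψ(z) ≤ exp((N+1)δ + K|s|((N+1)/2 + E(z)))` (Maxwellian factor frozen, activity factor moved by the path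
length). [folklore] -/
theorem ratio_le (hθc : 0 < θc) (ha0 : ∀ x, 0 < a x) {δ K : ℝ} (hK0 : 0 ≤ K)
    (hK : ∀ x y : T3, |Real.log (a x) - Real.log (a y)| ≤ δ + K * Torus.euclidDist x y)
    {z : Config (N + 1) (Fin 3) T3} (hz : z ∈ Φ.good) (s : ℝ) :
    lgDensity σ a (fun _ => θc) (fun _ => uc) N (Φ.flow (-s) z) / lgDensity σ a (fun _ => θc) (fun _ => uc) N z ≤
      ENNReal.ofReal (Real.exp (((N : ℝ) + 1) * δ + K * (|s| * (((N : ℝ) + 1) / 2 + configEnergy z)))) := by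
  set Z : ℝ := canonicalPartition (Torus.geometry (Fin 3)) (hsDiameter σ N) (N + 1)
    (localGibbsProfile a (fun _ => uc) (fun _ => θc)) with hZdef
  have hZ0 : 0 ≤ Z := Literature.MathematicalPhysics.KineticTheory.canonicalPartition_nonneg _ _ _
    (localGibbsProfile_nonneg (fun x => (ha0 x).le) fun _ => hθc.le)
  simp only [lgDensity]
  rw [canonicalDensity_eq_of_mem (Φ.good_subset hz), canonicalDensity_eq_of_mem (Φ.good_subset (Φ.mapsTo_good (-s) hz)),
    ← hZdef]
  rcases hZ0.eq_or_lt with hZ | hZ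
  · -- degenerate partition function: both densities vanish
    simp [← hZ]
  -- positive partition function
  set A : Config (N + 1) (Fin 3) T3 → ℝ := fun y => ∏ i, a (y i).1 with hA
  set M : Config (N + 1) (Fin 3) T3 → ℝ := fun y => ∏ i, localMaxwellian 1 θc uc (y i).2 with hM
  have hApos : ∀ y, 0 < A y := fun y => Finset.prod_pos fun i _ => ha0 _
  have hMpos : ∀ y, 0 < M y := fun y => Finset.prod_pos fun i _ => localMaxwellian_pos one_pos hθc _ _
  have hMeq : M (Φ.flow (-s) z) = M z := prod_localMaxwellian_flow_eq Φ hz (-s) θc uc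
  have hden : 0 < Z⁻¹ * (A z * M z) := mul_pos (inv_pos.2 hZ) (mul_pos (hApos z) (hMpos z))
  change ENNReal.ofReal (Z⁻¹ * (A (Φ.flow (-s) z) * M (Φ.flow (-s) z))) / ENNReal.ofReal (Z⁻¹ * (A z * M z)) ≤ _
  rw [← ENNReal.ofReal_div_of_pos hden]
  refine ENNReal.ofReal_le_ofReal ?_
  have hquot : Z⁻¹ * (A (Φ.flow (-s) z) * M (Φ.flow (-s) z)) / (Z⁻¹ * (A z * M z)) = A (Φ.flow (-s) z) / A z := by
    rw [hMeq, mul_div_mul_left _ _ (inv_pos.2 hZ).ne', mul_div_mul_right _ _ (hMpos z).ne']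
  rw [hquot, hA]
  simp only
  rw [prod_activity_eq_exp ha0, prod_activity_eq_exp ha0, ← Real.exp_sub, ← Finset.sum_sub_distrib]
  refine Real.exp_le_exp.2 ?_
  -- the log-activity increment is bounded by the modulus and the total displacement
  have hterm : ∀ i, Real.log (a (Φ.flow (-s) z i).1) - Real.log (a (z i).1) ≤
      δ + K * Torus.euclidDist ((Φ.flow (-s) z i).1) ((z i).1) := fun i =>
    (le_abs_self _).trans (hK _ _)
  calc ∑ i, (Real.log (a (Φ.flow (-s) z i).1) - Real.log (a (z i).1))
      ≤ ∑ i, (δ + K * Torus.euclidDist ((Φ.flow (-s) z i).1) ((z i).1)) := Finset.sum_le_sum fun i _ => hterm i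
    _ = ((N : ℝ) + 1) * δ + K * ∑ i, Torus.euclidDist ((Φ.flow (-s) z i).1) ((z i).1) := by
        rw [Finset.sum_add_distrib, Finset.sum_const, Finset.card_univ, Fintype.card_fin, nsmul_eq_mul,
          ← Finset.mul_sum]
        push_cast
        ring
    _ ≤ ((N : ℝ) + 1) * δ + K * (|s| * (((N : ℝ) + 1) / 2 + configEnergy z)) := by
        gcongr
        exact sum_euclidDist_flow_neg_le Φ hz s

end Ratio

/-! ## §5 Statics: the exponential moment of the kinetic energy under a density-only local Gibbs law -/

section Statics

variable {θc : ℝ} {uc : V3} {a : T3 → ℝ}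

/-- The total mass of a local Gibbs law is at most one (it is `Z⁻¹ · Z`). [folklore] -/
theorem localGibbsLaw_univ_le_one (ha : Continuous a) (ha0 : ∀ x, 0 < a x) (hθc : 0 < θc) (σ : ℝ) (N : ℕ)
    (Φ : TFlow σ N) : localGibbsLaw σ a (fun _ => uc) (fun _ => θc) N Φ univ ≤ 1 := by
  rw [localGibbsLaw_eq, localGibbsMeasure_univ ha continuous_const continuous_const (fun x => (ha0 x).le)
    (fun _ => hθc) σ N]
  set Zp := posPartition a (hsDiameter σ N) (N + 1)
  have hZp : 0 ≤ Zp := posPartition_nonneg (fun x => (ha0 x).le) _ _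
  rw [← ENNReal.ofReal_mul (inv_nonneg.2 hZp), ← ENNReal.ofReal_one]
  refine ENNReal.ofReal_le_ofReal ?_
  rcases hZp.eq_or_lt with h | h
  · rw [← h]; simp
  · rw [inv_mul_cancel₀ h.ne']

/-- **Fibrewise bound, any reduced density**: if a measurable one-body velocity factor `g ≥ 0` has Gaussian integral
`∫ g dN(uc, θc) ≤ K`, then `∫ ∏ᵢ g(vᵢ) dλ_N ≤ K^{N+1}` under the density-only local Gibbs law (disintegration into
positions and independent Gaussian velocities, `lintegral_localGibbsMeasure`; total mass `≤ 1`). [folklore] -/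
theorem lintegral_prod_vel_le_pow (ha : Continuous a) (ha0 : ∀ x, 0 < a x) (hθc : 0 < θc) (σ : ℝ) (N : ℕ)
    (Φ : TFlow σ N) {g : V3 → ℝ≥0∞} (hg : Measurable g) {K : ℝ≥0∞} (hK : ∫⁻ v, g v ∂gaussMeasure uc θc ≤ K)
    (hKtop : K ≠ ∞) :
    ∫⁻ z, ∏ i, g (z i).2 ∂(localGibbsLaw σ a (fun _ => uc) (fun _ => θc) N Φ) ≤ K ^ (N + 1) := by
  have hGm : Measurable fun z : Config (N + 1) (Fin 3) T3 => ∏ i, g (z i).2 :=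
    Finset.measurable_prod _ fun i _ => hg.comp ((measurable_pi_apply i).snd)
  have hmass := localGibbsLaw_univ_le_one (uc := uc) ha ha0 hθc σ N Φ
  rw [localGibbsLaw_eq] at hmass ⊢
  -- velocity fibres
  have hvel : ∀ x : Fin (N + 1) → T3,
      ∫⁻ v, (∏ i, g ((zipConfig (x, v) i).2)) ∂velMeasure (fun _ => uc) (fun _ => θc) x ≤ K ^ (N + 1) := by
    intro x
    have h1 : ∫⁻ v, (∏ i, g ((zipConfig (x, v) i).2)) ∂velMeasure (fun _ => uc) (fun _ => θc) x =
        ∏ _i : Fin (N + 1), ∫⁻ w, g w ∂gaussMeasure uc θc := by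
      simp only [zipConfig_apply, velMeasure]
      exact lintegral_fintype_prod_eq_prod' (fun _ => gaussMeasure uc θc) (f := fun _ w => g w) fun _ => hg
    rw [h1]
    calc ∏ _i : Fin (N + 1), ∫⁻ w, g w ∂gaussMeasure uc θc ≤ K ^ (Finset.univ : Finset (Fin (N + 1))).card :=
          Finset.prod_le_pow_card _ _ _ fun _ _ => hK
      _ = K ^ (N + 1) := by rw [Finset.card_univ, Fintype.card_fin]
  -- the mass of the position marginal is the total mass `≤ 1`
  set W : (Fin (N + 1) → T3) → ℝ≥0∞ := fun x => ENNReal.ofReal ((canonicalPartition (Torus.geometry (Fin 3))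
    (hsDiameter σ N) (N + 1) (localGibbsProfile a (fun _ => uc) (fun _ => θc)))⁻¹ * posWeight a (hsDiameter σ N) (N + 1) x)
  have hunit := lintegral_localGibbsMeasure (u₀ := fun _ => uc) ha continuous_const continuous_const
    (fun x => (ha0 x).le) (fun _ => hθc) σ N (G := fun _ => (1 : ℝ≥0∞)) measurable_const
  simp only [lintegral_const, measure_univ, mul_one, one_mul] at hunit
  rw [lintegral_localGibbsMeasure ha continuous_const continuous_const (fun x => (ha0 x).le) (fun _ => hθc) σ N hGm]
  calc ∫⁻ x, W x * ∫⁻ v, (∏ i, g ((zipConfig (x, v) i).2)) ∂velMeasure (fun _ => uc) (fun _ => θc) x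
      ≤ ∫⁻ x, W x * K ^ (N + 1) := lintegral_mono fun x => mul_le_mul' le_rfl (hvel x)
    _ = (∫⁻ x, W x) * K ^ (N + 1) := lintegral_mul_const' _ _ (ENNReal.pow_ne_top hKtop)
    _ ≤ 1 * K ^ (N + 1) := mul_le_mul' (by rw [← hunit]; exact hmass) le_rfl
    _ = K ^ (N + 1) := one_mul _

/-- **Exponential moment of the kinetic energy**: for `0 ≤ c ≤ 1/(4θc)`,
`∫ exp(c·E(z)) dλ_N ≤ exp((1 + 2‖uc‖² + 12θc)(c/2)(N+1))` — `exp(c E) ≤ ∏ᵢ exp((c/2)(1 + ‖vᵢ‖²))`, Gaussian fibres,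
one-site bound `KineticWindowGronwallWindowEnergyMoment.lintegral_exp_mul_one_add_sq_norm_gaussMeasure_le`. [folklore] -/
theorem lintegral_exp_mul_configEnergy_le (ha : Continuous a) (ha0 : ∀ x, 0 < a x) (hθc : 0 < θc) (σ : ℝ) (N : ℕ)
    (Φ : TFlow σ N) {c : ℝ} (hc0 : 0 ≤ c) (hc : c ≤ 1 / (4 * θc)) :
    ∫⁻ z, ENNReal.ofReal (Real.exp (c * configEnergy z)) ∂(localGibbsLaw σ a (fun _ => uc) (fun _ => θc) N Φ) ≤
      ENNReal.ofReal (Real.exp ((1 + 2 * ‖uc‖ ^ 2 + 12 * θc) * (c / 2) * ((N : ℝ) + 1))) := by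
  set g : V3 → ℝ≥0∞ := fun v => ENNReal.ofReal (Real.exp (c / 2 * (1 + ‖v‖ ^ 2))) with hgdef
  have hgm : Measurable g := (Real.continuous_exp.comp (by fun_prop)).measurable.ennreal_ofReal
  set K : ℝ≥0∞ := ENNReal.ofReal (Real.exp ((1 + 2 * ‖uc‖ ^ 2 + 12 * θc) * (c / 2))) with hKdef
  have hK : ∫⁻ v, g v ∂gaussMeasure uc θc ≤ K :=
    KineticWindowGronwallWindowEnergyMoment.lintegral_exp_mul_one_add_sq_norm_gaussMeasure_le hθc le_rfl le_rfl
      (by positivity) (by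
        rw [div_le_div_iff₀ two_pos (by positivity)]
        have h4 : c * (4 * θc) ≤ 1 := (le_div_iff₀ (by positivity)).mp hc
        linarith)
  -- pointwise: `exp(c E) ≤ ∏ᵢ g(vᵢ)`
  have hpt : ∀ z : Config (N + 1) (Fin 3) T3, ENNReal.ofReal (Real.exp (c * configEnergy z)) ≤ ∏ i, g (z i).2 := by
    intro z
    simp only [hgdef]
    rw [← ENNReal.ofReal_prod_of_nonneg fun i _ => (Real.exp_pos _).le, ← Real.exp_sum]
    refine ENNReal.ofReal_le_ofReal (Real.exp_le_exp.2 ?_)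
    have h1 : c * configEnergy z = ∑ i, c / 2 * ‖(z i).2‖ ^ 2 := by
      simp only [configEnergy, Finset.mul_sum]
      exact Finset.sum_congr rfl fun i _ => by ring
    rw [h1]
    exact Finset.sum_le_sum fun i _ => by nlinarith [sq_nonneg ‖(z i).2‖]
  calc ∫⁻ z, ENNReal.ofReal (Real.exp (c * configEnergy z)) ∂(localGibbsLaw σ a (fun _ => uc) (fun _ => θc) N Φ)
      ≤ ∫⁻ z, ∏ i, g (z i).2 ∂(localGibbsLaw σ a (fun _ => uc) (fun _ => θc) N Φ) := lintegral_mono hpt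
    _ ≤ K ^ (N + 1) := lintegral_prod_vel_le_pow ha ha0 hθc σ N Φ hgm hK ENNReal.ofReal_ne_top
    _ = ENNReal.ofReal (Real.exp ((1 + 2 * ‖uc‖ ^ 2 + 12 * θc) * (c / 2) * ((N : ℝ) + 1))) := by
        rw [hKdef, ← ENNReal.ofReal_pow (Real.exp_pos _).le, ← Real.exp_nat_mul]
        push_cast
        ring_nf

end Statics

/-! ## §6 Assembly: the registered stub -/

/-- **`stub_densityOnlyWindowRenyi`: the registered statement `DensityOnlyWindowRenyi` holds.** [folklore] -/
theorem stub_densityOnlyWindowRenyi : DensityOnlyWindowRenyi := by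
  intro θc hθc uc a ha ha0 σ p hp τ ε _hτ hε
  have hp0 : 0 < p := one_pos.trans_le hp
  -- the affine modulus of the log-activity at precision `δ = ε/(2p)`
  have hg : Continuous fun x => Real.log (a x) := ha.log fun x => (ha0 x).ne'
  obtain ⟨K, hK0, hK⟩ := exists_affine_modulus hg (δ := ε / (2 * p)) (by positivity)
  set C : ℝ := 1 + 2 * ‖uc‖ ^ 2 + 12 * θc with hC
  have hC0 : 0 < C := by positivity
  set h₀ : ℝ := min (1 / (4 * θc * (p * K + 1))) (ε / ((p * K + 1) * (1 + C))) with hh₀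
  have hh₀pos : 0 < h₀ := lt_min (by positivity) (by positivity)
  -- the window length `τ (N+1)^{-1/3}` tends to `0` (cf. `ClampedCurrentsDockCubicChannelPrelim.tendsto_window_zero`)
  have hwin : Tendsto (fun N : ℕ => τ * ((N : ℝ) + 1) ^ (-(1 / 3 : ℝ))) atTop (𝓝 0) := by
    simpa using ((tendsto_rpow_neg_atTop (by norm_num : (0 : ℝ) < 1 / 3)).comp
      (tendsto_atTop_add_const_right _ 1 tendsto_natCast_atTop_atTop)).const_mul τ
  obtain ⟨N₀, hN₀⟩ := eventually_atTop.1 (hwin.eventually (Iic_mem_nhds hh₀pos))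
  refine ⟨N₀, fun N hN Φ s hs => ?_⟩
  have hsN : |s| ≤ h₀ := hs.trans (hN₀ N hN)
  have hs1 : |s| ≤ 1 / (4 * θc * (p * K + 1)) := hsN.trans (min_le_left _ _)
  have hs2 : |s| ≤ ε / ((p * K + 1) * (1 + C)) := hsN.trans (min_le_right _ _)
  have hs0 : 0 ≤ |s| := abs_nonneg s
  -- the tilt of the energy moment `c = p K |s| ≤ 1/(4θc)`
  set c : ℝ := p * K * |s| with hc
  have hc0 : 0 ≤ c := by positivity
  have hpK : p * K ≤ p * K + 1 := by linarith
  have hcle : c ≤ (p * K + 1) * |s| := by rw [hc]; exact mul_le_mul_of_nonneg_right hpK hs0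
  have hc1 : c ≤ 1 / (4 * θc) := by
    calc c ≤ (p * K + 1) * |s| := hcle
      _ ≤ (p * K + 1) * (1 / (4 * θc * (p * K + 1))) := mul_le_mul_of_nonneg_left hs1 (by positivity)
      _ = 1 / (4 * θc) := by field_simp
  have hc2 : c * (1 + C) ≤ ε := by
    calc c * (1 + C) ≤ (p * K + 1) * |s| * (1 + C) := mul_le_mul_of_nonneg_right hcle (by positivity)
      _ ≤ (p * K + 1) * (ε / ((p * K + 1) * (1 + C))) * (1 + C) :=
          mul_le_mul_of_nonneg_right (mul_le_mul_of_nonneg_left hs2 (by positivity)) (by positivity)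
      _ = ε := by field_simp
  set P := localGibbsLaw σ a (fun _ => uc) (fun _ => θc) N Φ with hP
  set A : ℝ := p * (((N : ℝ) + 1) * (ε / (2 * p)) + K * (|s| * (((N : ℝ) + 1) / 2))) with hA
  -- a.e. pointwise bound on good orbits
  have hpt : ∀ᵐ z ∂P, (lgDensity σ a (fun _ => θc) (fun _ => uc) N (Φ.flow (-s) z) /
        lgDensity σ a (fun _ => θc) (fun _ => uc) N z) ^ p ≤
      ENNReal.ofReal (Real.exp A) * ENNReal.ofReal (Real.exp (c * configEnergy z)) := by
    filter_upwards [KineticWindowGronwallQuadraticMoment.ae_mem_good_localGibbsLaw σ a (fun _ => uc) (fun _ => θc) N Φ]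
      with z hz
    refine (ENNReal.rpow_le_rpow (ratio_le Φ (uc := uc) hθc ha0 hK0 hK hz s) hp0.le).trans_eq ?_
    rw [ENNReal.ofReal_rpow_of_nonneg (Real.exp_pos _).le hp0.le, ← Real.exp_mul,
      ← ENNReal.ofReal_mul (Real.exp_pos _).le, ← Real.exp_add]
    congr 2
    rw [hc, hA]
    ring
  calc ∫⁻ z, (lgDensity σ a (fun _ => θc) (fun _ => uc) N (Φ.flow (-s) z) /
          lgDensity σ a (fun _ => θc) (fun _ => uc) N z) ^ p ∂P
      ≤ ∫⁻ z, ENNReal.ofReal (Real.exp A) * ENNReal.ofReal (Real.exp (c * configEnergy z)) ∂P := lintegral_mono_ae hpt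
    _ = ENNReal.ofReal (Real.exp A) * ∫⁻ z, ENNReal.ofReal (Real.exp (c * configEnergy z)) ∂P :=
        lintegral_const_mul' _ _ ENNReal.ofReal_ne_top
    _ ≤ ENNReal.ofReal (Real.exp A) * ENNReal.ofReal (Real.exp ((1 + 2 * ‖uc‖ ^ 2 + 12 * θc) * (c / 2) * ((N : ℝ) + 1))) :=
        mul_le_mul' le_rfl (lintegral_exp_mul_configEnergy_le ha ha0 hθc σ N Φ hc0 hc1)
    _ = ENNReal.ofReal (Real.exp (((N : ℝ) + 1) * (ε / 2 + c / 2 + C * (c / 2)))) := by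
        rw [← ENNReal.ofReal_mul (Real.exp_pos _).le, ← Real.exp_add, hC, hc, hA]
        congr 2
        field_simp
    _ ≤ ENNReal.ofReal (Real.exp (ε * ((N : ℝ) + 1))) := by
        refine ENNReal.ofReal_le_ofReal (Real.exp_le_exp.2 ?_)
        have hN1 : (0 : ℝ) ≤ (N : ℝ) + 1 := by positivity
        have key : ε / 2 + c / 2 + C * (c / 2) ≤ ε := by nlinarith
        nlinarith

end Summit.AtomisticToContinuum.HydrodynamicLimit.Theorems.KineticWindowGronwallDensityOnlyWindowRenyi

end
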